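import Summits.AtomisticToContinuum.BoseEinsteinCondensation.Theorems.BoxCountShadowInsertion
import HarnessLib

/-!
# BoxCountShadowDisplacement — continuation of BoxCountShadowInsertion: the displacement door (§8b)

Continuation of `BoxCountShadowInsertion` (same namespace).  The door for the residual with a NAMED input
class: `nbrs` (ℓ^∞-neighbour cells), `cellPairMass`, the pieces `GroundStateHorizonDisplacement` (DISP_h:
one-coordinate displacement quasi-invariance of `|Ψ₀|²` by one horizon cell, integrated over count fibres) and
`GroundStateHorizonRingShare` (RSH_h: local non-depletion, mild), the kernel
`horizonCellInsertion_of_displacement : DISP_h → RSH_h → INS_h` and `bec_of_displacement₀`.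
No instances, no notation, no sorry.
-/

open MeasureTheory Filter Set
open scoped ENNReal NNReal BigOperators

namespace Summit.AtomisticToContinuum.BoseEinsteinCondensation.Theorems.BoxCountShadow

open Literature.MathematicalPhysics.QuantumManyBody.BoseGas
open Summit.AtomisticToContinuum.BoseEinsteinCondensation.Theorems.BoxLatticeFSum
open Summit.AtomisticToContinuum.BoseEinsteinCondensation.Theorems.BoxLabelAffinity
open Summit.AtomisticToContinuum.BoseEinsteinCondensation.Theorems.BoxHorizonAffinity

variable {n : ℕ}

/-! ### §8b  The displacement door: DISP_h ∧ RSH_h ⟹ INS_h (local one-particle moves suffice) -/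

/-- The `ℓ^∞`-neighbours of a sub-cell of the `K`-grid (distinct cells at index distance `≤ 1`). [folklore] -/
def nbrs {K : ℕ} (B : SubIdx K) : Set (SubIdx K) :=
  {B' | B' ≠ B ∧ ∀ i : Fin 3, (B i : ℕ) ≤ (B' i : ℕ) + 1 ∧ (B' i : ℕ) ≤ (B i : ℕ) + 1}

/-- `Q_{B→B'}(j) = ∫_{m_B(Y) = j} q_{B'}(Y) dY`: joint weight of «the others have `j` particles in `B`, the tagged
particle lies in `B'`» (`B' = B` gives `cellMass`). [folklore] -/
noncomputable def cellPairMass (L : ℝ) (K : ℕ) (Φ : Config (n + 1) → ℝ) (B B' : SubIdx K) (j : ℕ) : ℝ≥0∞ :=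
  ∫⁻ Y in ((fun m : SubIdx K → ℕ => m B) ∘ countVec (L / (K : ℝ)) K) ⁻¹' {j}, blockMass L K Φ B' Y

/-- `cellPairMass` on the diagonal `B' = B` is `cellMass`. [folklore] -/
theorem cellPairMass_self (L : ℝ) (K : ℕ) (Φ : Config (n + 1) → ℝ) (B : SubIdx K) (j : ℕ) :
    cellPairMass L K Φ B B j = cellMass L K Φ B j := rfl

/-- **DISP_h(η)** (door · TAG STRONGER-type (a sufficient condition with RSH_h for INS_h ⟺ MARG_h) · UNDECIDED ·
TRUE-type expected (heuristic `κ₁ = 1 − O((ρa³)^{1/4})`) · leaf IDEA-NEEDED·positivity, class = ONE-COORDINATE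
DISPLACEMENT QUASI-INVARIANCE at the horizon scale) `GroundStateHorizonDisplacement η`: on a pair set `G₁` whose
complement has weight `≤ 1/4`, for EVERY cell `B'` adjacent to `B`,
`κ₁ · ∫_{m_B(Y)=j} q_{B'}(Y) dY ≤ ∫_{m_B(Y)=j} q_B(Y) dY`: given that the others have `j` particles in `B`, the
tagged particle is at least `κ₁` times as likely to sit in `B` as in any adjacent cell — the law of `|Ψ₀|²` is
quasi-invariant under displacing ONE particle by one horizon cell (a local Harnack inequality in one coordinate at
scale `ℓ_h`, integrated over a count fibre; `N`-uniform because one coordinate moves and the move is local).  Why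
it might fail: `x ↦ Ψ₀(x,Y)` obeys no closed equation (the other Laplacians); near-jammed fibres (large `j`) are
genuinely non-invariant, whence the exceptional set.
[cite: LSSY2005, Thm 7.1; GhoshPeres2017, DOI 10.1215/00127094-2017-0002] -/
@[conjecture] def GroundStateHorizonDisplacement (η : ℝ≥0) : Prop :=
  ∀ v : ℝ → ℝ≥0∞, IsRepulsiveFiniteRange v → 0 < scatteringLength v →
    ∃ M₀ : ℝ, 0 < M₀ ∧ ∀ M : ℝ, M₀ ≤ M → ∃ κ₁ : ℝ, 0 < κ₁ ∧ ∃ ρ₀ : ℝ, 0 < ρ₀ ∧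
      ∀ ρ : ℝ, 0 < ρ → ρ < ρ₀ → ∀ᶠ n : ℕ in atTop,
        (∃ Ψ₀ : Config (n + 1) → ℝ, (∀ X, 0 ≤ Ψ₀ X) ∧
          IsGroundState v (sideLength ρ (n + 1)) (fun X => (Ψ₀ X : ℂ))) →
        ∀ K : ℕ, 0 < K → InWindow (M * ρ ^ (-(η : ℝ))) ρ (sideLength ρ (n + 1)) K →
          ∃ G₁ : Set (SubIdx K × ℕ),
            pairWeightOn (sideLength ρ (n + 1)) K (groundState v (n + 1) (sideLength ρ (n + 1))) G₁ᶜ ≤ 1 / 4 ∧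
              ∀ (B : SubIdx K) (j : ℕ), (B, j) ∈ G₁ → ∀ B' ∈ nbrs B,
                ENNReal.ofReal κ₁ *
                    cellPairMass (sideLength ρ (n + 1)) K (groundState v (n + 1) (sideLength ρ (n + 1))) B B' j ≤
                  cellMass (sideLength ρ (n + 1)) K (groundState v (n + 1) (sideLength ρ (n + 1))) B j

/-- **RSH_h(η)** (support-type door · TAG MILD (holds in the number-locked model on all but `O(K⁻³)` weight) ·
UNDECIDED · leaf ATTACKABLE·density, class = local density non-depletion around a cell given its count)
`GroundStateHorizonRingShare η`: on a pair set `G₂` whose complement has weight `≤ 1/4`, SOME cell `B'` adjacent to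
`B` receives the tagged particle at rate `≥ θ ×` fair share on the fibre `m_B = j`:
`θ · K^{-3} · P̄_B(j) ≤ ∫_{m_B(Y)=j} q_{B'}(Y) dY` (the neighbourhood of a cell is not depleted given the cell's own
count).  Why it might fail: only through a conspiracy between a cell's count and the emptiness of ALL its 26
neighbours on a set of pairs of weight `> 1/4` — excluded heuristically by incompressibility at scale `ℓ_h`.
[cite: LSSY2005, Thm 7.1] -/
@[conjecture] def GroundStateHorizonRingShare (η : ℝ≥0) : Prop :=
  ∀ v : ℝ → ℝ≥0∞, IsRepulsiveFiniteRange v → 0 < scatteringLength v →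
    ∃ M₀ : ℝ, 0 < M₀ ∧ ∀ M : ℝ, M₀ ≤ M → ∃ θ : ℝ, 0 < θ ∧ ∃ ρ₀ : ℝ, 0 < ρ₀ ∧
      ∀ ρ : ℝ, 0 < ρ → ρ < ρ₀ → ∀ᶠ n : ℕ in atTop,
        (∃ Ψ₀ : Config (n + 1) → ℝ, (∀ X, 0 ≤ Ψ₀ X) ∧
          IsGroundState v (sideLength ρ (n + 1)) (fun X => (Ψ₀ X : ℂ))) →
        ∀ K : ℕ, 0 < K → InWindow (M * ρ ^ (-(η : ℝ))) ρ (sideLength ρ (n + 1)) K →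
          ∃ G₂ : Set (SubIdx K × ℕ),
            pairWeightOn (sideLength ρ (n + 1)) K (groundState v (n + 1) (sideLength ρ (n + 1))) G₂ᶜ ≤ 1 / 4 ∧
              ∀ (B : SubIdx K) (j : ℕ), (B, j) ∈ G₂ → ∃ B' ∈ nbrs B,
                ENNReal.ofReal θ *
                    pairWeight (sideLength ρ (n + 1)) K (groundState v (n + 1) (sideLength ρ (n + 1))) (B, j) ≤
                  cellPairMass (sideLength ρ (n + 1)) K (groundState v (n + 1) (sideLength ρ (n + 1))) B B' j

/-- **DISP_h ∧ RSH_h ⟹ INS_h** (`κ = κ₁θ`, `δ = 1/2`, `G = G₁ ∩ G₂`): local one-particle moves suffice for the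
residual. [folklore] -/
theorem horizonCellInsertion_of_displacement (η : ℝ≥0) (hdisp : GroundStateHorizonDisplacement η)
    (hrsh : GroundStateHorizonRingShare η) : GroundStateHorizonCellInsertion η := by
  intro v hv ha
  obtain ⟨M₁, hM₁, h₁⟩ := hdisp v hv ha
  obtain ⟨M₂, hM₂, h₂⟩ := hrsh v hv ha
  refine ⟨max M₁ M₂, lt_max_of_lt_left hM₁, fun M hM => ?_⟩
  obtain ⟨κ₁, hκ₁, ρ₁, hρ₁, h₁'⟩ := h₁ M ((le_max_left _ _).trans hM)
  obtain ⟨θ, hθ, ρ₂, hρ₂, h₂'⟩ := h₂ M ((le_max_right _ _).trans hM)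
  refine ⟨κ₁ * θ, mul_pos hκ₁ hθ, 1 / 2, one_half_pos, min ρ₁ ρ₂, lt_min hρ₁ hρ₂, fun ρ hρ hρlt => ?_⟩
  filter_upwards [h₁' ρ hρ (hρlt.trans_le (min_le_left _ _)),
    h₂' ρ hρ (hρlt.trans_le (min_le_right _ _))] with n hn₁ hn₂ hex K hK hKw
  have hA : 0 < M * ρ ^ (-(η : ℝ)) :=
    mul_pos ((lt_max_of_lt_left hM₁).trans_le hM) (Real.rpow_pos_of_pos hρ _)
  set L := sideLength ρ (n + 1) with hLdef
  have hL : 0 < L := sideLength_pos_of_inWindow hA hρ hK hKw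
  set Φ := groundState v (n + 1) L with hΦdef
  have hΦm : Measurable Φ := measurable_groundState v (n + 1) L
  have hΦ1 : ∫⁻ Y : Config n, ∫⁻ x, ENNReal.ofReal (Φ (Matrix.vecCons x Y)) ^ 2 = 1 := by
    rw [← lintegral_eq_lintegral_lintegral_vecCons (hΦm.ennreal_ofReal.pow_const 2)]
    exact lintegral_groundState_sq hex
  obtain ⟨G₁, hG₁, hD⟩ := hn₁ hex K hK hKw
  obtain ⟨G₂, hG₂, hR⟩ := hn₂ hex K hK hKw
  refine ⟨G₁ ∩ G₂, ?_, ?_⟩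
  · -- weight of the intersection ≥ 1/2
    have htot : pairWeightOn L K Φ (G₁ ∩ G₂) + pairWeightOn L K Φ (G₁ ∩ G₂)ᶜ = 1 := by
      rw [pairWeightOn_add_compl, pairWeightOn_univ hK hΦ1]
    have hc : pairWeightOn L K Φ (G₁ ∩ G₂)ᶜ ≤ 1 / 2 :=
      calc pairWeightOn L K Φ (G₁ ∩ G₂)ᶜ ≤ pairWeightOn L K Φ G₁ᶜ + pairWeightOn L K Φ G₂ᶜ :=
            pairWeightOn_compl_inter_le L K Φ G₁ G₂
        _ ≤ 1 / 4 + 1 / 4 := add_le_add hG₁ hG₂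
        _ = 1 / 2 := by
            rw [← two_mul, ENNReal.div_eq_inv_mul, ENNReal.div_eq_inv_mul, mul_one, mul_one]
            rw [show (4 : ℝ≥0∞) = 2 * 2 by norm_num, ENNReal.mul_inv (Or.inl two_ne_zero) (Or.inl ENNReal.ofNat_ne_top),
              ← mul_assoc, ENNReal.mul_inv_cancel two_ne_zero ENNReal.ofNat_ne_top, one_mul]
    have hhalf : ENNReal.ofReal (1 / 2) = 1 / 2 := by
      rw [ENNReal.ofReal_div_of_pos two_pos, ENNReal.ofReal_one, ENNReal.ofReal_ofNat]
    rw [hhalf]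
    have hfin : (1 / 2 : ℝ≥0∞) ≠ ∞ := ENNReal.div_ne_top ENNReal.one_ne_top two_ne_zero
    have key : 1 / 2 + 1 / 2 ≤ pairWeightOn L K Φ (G₁ ∩ G₂) + 1 / 2 :=
      calc (1 / 2 : ℝ≥0∞) + 1 / 2 = 1 := ENNReal.add_halves 1
        _ = pairWeightOn L K Φ (G₁ ∩ G₂) + pairWeightOn L K Φ (G₁ ∩ G₂)ᶜ := htot.symm
        _ ≤ pairWeightOn L K Φ (G₁ ∩ G₂) + 1 / 2 := add_le_add le_rfl hc
    exact (ENNReal.add_le_add_iff_right hfin).1 key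
  · intro B j hp
    obtain ⟨B', hadj, hθB⟩ := hR B j hp.2
    have hκB := hD B j hp.1 B' hadj
    calc ENNReal.ofReal (κ₁ * θ) * pairWeight L K Φ (B, j)
        = ENNReal.ofReal κ₁ * (ENNReal.ofReal θ * pairWeight L K Φ (B, j)) := by
          rw [ENNReal.ofReal_mul hκ₁.le, mul_assoc]
      _ ≤ ENNReal.ofReal κ₁ * cellPairMass L K Φ B B' j := mul_le_mul' le_rfl hθB
      _ ≤ cellMass L K Φ B j := hκB

/-- The kernel through the displacement door:
UGS → LOC_h(η) → DISP_h(η) → RSH_h(η) → CSUF_h(η) → SUF_h(η) → `BoseEinsteinCondensation`. [folklore] -/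
theorem bec_of_displacement₀ (η : ℝ≥0) (hU : BoxGroundStateUniqueness)
    (hloc : GroundStateHorizonCondensation η) (hdisp : GroundStateHorizonDisplacement η)
    (hrsh : GroundStateHorizonRingShare η) (hcsuf : GroundStateHorizonCellCountSufficiency η)
    (hsuf : GroundStateHorizonCountSufficiency η) : _root_.BoseEinsteinCondensation :=
  bec_of_cellCountPieces₀ η hU hloc
    (horizonCellCountAffinity_of_insertion η (horizonCellInsertion_of_displacement η hdisp hrsh)) hcsuf hsuf

end Summit.AtomisticToContinuum.BoseEinsteinCondensation.Theorems.BoxCountShadow
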